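import Summits.Parity.GeneralizedHardyLittlewood.Theorems.LiouvilleShiftedTablesDefs
import Summits.Parity.GeneralizedHardyLittlewood.Theorems.LiouvilleShiftedTablesBVLiouville
import Summits.Parity.GeneralizedHardyLittlewood.Theorems.LiouvilleShiftedTablesTypeI2DilatedWindow
import Summits.Parity.GeneralizedHardyLittlewood.Theorems.LiouvilleShiftedTablesTypeI2DilatedPeel6
import Summits.Parity.GeneralizedHardyLittlewood.Theorems.LiouvilleShiftedTablesTypeI2DilatedStubMainTerms
import Summits.Parity.GeneralizedHardyLittlewood.Theorems.LiouvilleShiftedTablesTypeI2DilatedURBound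
import Summits.Parity.GeneralizedHardyLittlewood.Theorems.LiouvilleShiftedTablesTypeI2DilatedAssemble6

/-!
# `TypeI2Dilated` modulo the named facts (line `peel-to-drappeau`, crux stmt-Parity-14272)

The crux `Summit.Parity.GeneralizedHardyLittlewood.Theses.LiouvilleShiftedTables.TypeI2Dilated` of the route
`LiouvilleShiftedTables` (Parity / GeneralizedHardyLittlewood) follows from the two published deep inputs of the
line, packaged as `LineFacts = DrappeauTypeII ∧ DilatedDivisorAP`, i.e. the Literature NAMED FACTS
`Literature.NumberTheory.Sieve.Drappeau2017_theorem51` (S. Drappeau, Proc. LMS 114 (2017), Théorème 5.1: the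
trilinear `𝔲_R`-dispersion estimate) and `Literature.NumberTheory.Sieve.FouvryTenenbaum2021_lemma412 ∧ …_lemma413`
(É. Fouvry, G. Tenenbaum, Trans. AMS (2021), Lemmas 4.12–4.13: divisor functions in arithmetic progressions to
large moduli).  Everything else is PROVED in the tree: the peel (`stub_peel`, files `…TypeI2DilatedPeel1–6`), the
window (`stub_window`, `…TypeI2DilatedWindow*`), the double-family Bombieri–Vinogradov main terms
(`stub_mainTerms`, `…TypeI2DilatedMainTerms1–8`, `…StubMainTerms`), the `𝔲_R`-terms (`stub_uRBound`, `…TypeI2DilatedURB1–11`,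
`…URBound`), the assembly (`stub_assembleFrom`, `…TypeI2DilatedAssemble1–6`) and Bombieri–Vinogradov for `λ`
(`stub_bvLiouville`, `…BVLiouville`).

* `TypeI2Dilated_of_lineFacts : LineFacts → TypeI2Dilated` — the CONDITIONAL closing theorem of the crux;
* `TypeI2Dilated_of_namedFacts` — the same with the three named facts as separate hypotheses.

This is a conditional result (the hypotheses are unproved published theorems stated as `def … : Prop` in
`Literature/NumberTheory/Sieve/DrappeauDispersion.lean` and `…/FouvryTenenbaumDivisorAP.lean`); it becomes the
unconditional closing theorem the moment `Drappeau2017_theorem51_holds` and `FouvryTenenbaum2021_lemma41{2,3}_holds` land.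
[this line: Lines/peel-to-drappeau.md; cite: Drappeau2017, Thm 5.1; FouvryTenenbaum2021, Lemmas 4.12–4.13]
-/

noncomputable section

namespace Summit.Parity.GeneralizedHardyLittlewood.Cruxes.TypeI2Dilated.PeelToDrappeau

open Literature.NumberTheory.Sieve

/-- **The crux `TypeI2Dilated` modulo the line's named facts**: `LineFacts → TypeI2Dilated`, by the kernel-checked
composition `assembleFrom uRBound (window (peel facts.1)) (mainTerms bv) facts.2 bv` of the six landed stubs.
Conditional on `LineFacts = Drappeau2017_theorem51 ∧ (FouvryTenenbaum2021_lemma412 ∧ FouvryTenenbaum2021_lemma413)`.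
[this line; cite: Drappeau2017, Thm 5.1; FouvryTenenbaum2021, Lemmas 4.12–4.13] -/
theorem TypeI2Dilated_of_lineFacts (hF : LineFacts) :
    Summit.Parity.GeneralizedHardyLittlewood.Theses.LiouvilleShiftedTables.TypeI2Dilated :=
  (show DilatedTypeII → DilatedMainTerms → DilatedDivisorAP →
      Summit.Parity.GeneralizedHardyLittlewood.Theses.LiouvilleShiftedTables.BVLiouville →
      Summit.Parity.GeneralizedHardyLittlewood.Theses.LiouvilleShiftedTables.TypeI2Dilated
      from (show URBound → AssembleStep from stub_assembleFrom) stub_uRBound)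
    ((show DilatedTypeIICore → DilatedTypeII from stub_window)
      ((show DrappeauTypeII → DilatedTypeIICore from stub_peel) hF.1))
    ((show Summit.Parity.GeneralizedHardyLittlewood.Theses.LiouvilleShiftedTables.BVLiouville →
        DilatedMainTerms from stub_mainTerms) stub_bvLiouville)
    hF.2 stub_bvLiouville

/-- The same with the three Literature named facts as explicit hypotheses:
`Drappeau2017_theorem51 → FouvryTenenbaum2021_lemma412 → FouvryTenenbaum2021_lemma413 → TypeI2Dilated`.
[this line; cite: Drappeau2017, Thm 5.1; FouvryTenenbaum2021, Lemmas 4.12–4.13] -/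
theorem TypeI2Dilated_of_namedFacts (h51 : Drappeau2017_theorem51) (h412 : FouvryTenenbaum2021_lemma412)
    (h413 : FouvryTenenbaum2021_lemma413) :
    Summit.Parity.GeneralizedHardyLittlewood.Theses.LiouvilleShiftedTables.TypeI2Dilated :=
  TypeI2Dilated_of_lineFacts ⟨h51, h412, h413⟩

end Summit.Parity.GeneralizedHardyLittlewood.Cruxes.TypeI2Dilated.PeelToDrappeau

end
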